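import Summits.Schanuel.Schanuel.Theorems.ZilberEacAlgebraicCurvesAll
import Summits.Schanuel.Schanuel.Theorems.ZilberEacLineBaseComplete
import Summits.Schanuel.Schanuel.Theorems.ZilberEacCurveGraphFibreCase
import HarnessLib

/-!
# Arbitrary base branches, LXXXVIII: THE VERDICT for polynomial-fibre surfaces over curves defined
# over `ℚ̄` — Mantova–Masser's question has a positive answer for every one of them

HONEST FRAMING.  Cell `pub-schanuel` (Zilber's Exponential-Algebraic Closedness, case ladder;
host summit Schanuel), seat 2, gen 32.  Mantova–Masser (PLMS 2024, §1 p. 5) ask whether every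
surface `W ⊆ ℂ² × (ℂˣ)²` of their case (dim-π-S-1-free) has Zariski-dense unprojected exponential
points.  **`unprojectedDense_planeCurve_polyFibre_algebraic_of_mmCase`**: for EVERY irreducible
`F ∈ ℚ̄[x₀][x₁]` (any degrees) and every `R ∈ ℂ[x₀, x₁]`, if the surface `{F = 0, y₀ = R(x₀, x₁)}`
is in their case then its exponential points ARE Zariski dense — no exception.  Assembly:
`x₁`-degree `0` (vertical lines) and lines of rational slope are excluded by the case itself; lines
of any other slope — gen 18 (`unprojectedDense_of_mmCase_of_base_eq_line`, every surface); every
other curve — file LXXXIV (`…_of_notLine`: gen 31's bounded places and rational graphs, gen 32's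
engines, Lindemann).  Also here: fibres in `y₁` (index swap) and the unconditional members of the
open cell EC(3,2) fibred over these surfaces (THEOREM F′ of gen 5).
What this is NOT: surfaces of the case over ℚ̄-curves that are not polynomial/rational-fibre
cylinders (fibre curves of `y₀`-degree `≥ 2`: decided over polynomial graphs, gen 26 + file LXXXVI,
OPEN over general curves); curves with transcendental coefficients (`{x₁ = x₀²/(2πi), y₀ = 1}` is
NOT dense); Fib(3,2); EC(3,2) — OPEN; the question OPEN in general; NOT Schanuel's conjecture
(neither used nor implied; Lindemann's theorem on `π` is used); EAC ⇏ SC.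
-/

noncomputable section

open Filter Topology Set Complex Polynomial
open Literature.NumberTheory.Transcendental Literature.ModelTheory.Zilber
open Literature.ModelTheory.ExponentialFields

set_option linter.dupNamespace false

namespace Summit.Schanuel.Schanuel.Theorems

section Verdict

variable (F : ℂ[X][X])

/-- `C f` irreducible in `ℂ[x₀][x₁]` ⟹ `f` irreducible in `ℂ[x₀]`. [folklore] -/
theorem irreducible_of_irreducible_C {f : ℂ[X]} (h : Irreducible (Polynomial.C f : ℂ[X][X])) :
    Irreducible f := by
  refine irreducible_iff.2 ⟨fun hu => h.not_isUnit (Polynomial.isUnit_C.2 hu), fun a b hab => ?_⟩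
  have h' := h.isUnit_or_isUnit (show (Polynomial.C f : ℂ[X][X]) = Polynomial.C a * Polynomial.C b by
    rw [hab, map_mul])
  exact h'.imp Polynomial.isUnit_C.1 Polynomial.isUnit_C.1

/-- **The closure of the additive projection of `{F = 0, y₀ = R} ∩ G²` is the curve `F = 0`**
(`F` irreducible, `R` nonzero somewhere on the curve). [folklore] -/
theorem zeroLocus_projAdd_planeCurve_polyFibre (hFirr : Irreducible F) (R : MvPolynomial (Fin 2) ℂ)
    (hR : ∃ x y : ℂ, (F.map (Polynomial.evalRingHom x)).eval y = 0 ∧ MvPolynomial.eval ![x, y] R ≠ 0) :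
    MvPolynomial.zeroLocus ℂ (MvPolynomial.vanishingIdeal ℂ (projAdd '' ({w : Fin 2 ⊕ Fin 2 → ℂ |
        (F.map (Polynomial.evalRingHom (w (Sum.inl 0)))).eval (w (Sum.inl 1)) = 0 ∧
        w (Sum.inr 0) = MvPolynomial.eval ![w (Sum.inl 0), w (Sum.inl 1)] R} ∩ torusLocus ℂ 2))) =
      {x : Fin 2 → ℂ | (F.map (Polynomial.evalRingHom (x 0))).eval (x 1) = 0} := by
  classical
  obtain ⟨Φr, hΦr⟩ := exists_rowsEquiv
  set A : MvPolynomial (Fin 2) ℂ := Φr.symm F with hA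
  have hPQ : ∀ x y : ℂ, MvPolynomial.eval ![x, y] A = (F.map (Polynomial.evalRingHom x)).eval y := by
    intro x y
    rw [hΦr, hA, RingEquiv.apply_symm_apply]
  have hirrA : Irreducible A := (irreducible_rows_iff hPQ).2 hFirr
  have hset : {w : Fin 2 ⊕ Fin 2 → ℂ |
      (F.map (Polynomial.evalRingHom (w (Sum.inl 0)))).eval (w (Sum.inl 1)) = 0 ∧
      w (Sum.inr 0) = MvPolynomial.eval ![w (Sum.inl 0), w (Sum.inl 1)] R} =
      {w : Fin 2 ⊕ Fin 2 → ℂ | MvPolynomial.eval ![w (Sum.inl 0), w (Sum.inl 1)] A = 0 ∧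
        w (Sum.inr 0) = MvPolynomial.eval ![w (Sum.inl 0), w (Sum.inl 1)] R} := by
    ext w
    simp only [Set.mem_setOf_eq, hPQ]
  have hpt : ∃ x : Fin 2 → ℂ, MvPolynomial.eval x A = 0 ∧ MvPolynomial.eval x R ≠ 0 := by
    obtain ⟨x, y, hxy, hne⟩ := hR
    exact ⟨![x, y], by rw [hPQ]; exact hxy, hne⟩
  rw [hset, vanishingIdeal_projAdd_curveGraphFibre hirrA hpt]
  ext x
  rw [mem_zeroLocus_span_singleton_iff, Set.mem_setOf_eq]
  change MvPolynomial.eval x A = 0 ↔ _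
  have e : (![x 0, x 1] : Fin 2 → ℂ) = x := by funext j; fin_cases j <;> rfl
  rw [← hPQ, e]

/-- **THE VERDICT.**  For every irreducible `F ∈ ℂ[x₀][x₁]` with algebraic coefficients and every
`R ∈ ℂ[x₀, x₁]`: if `{F = 0, y₀ = R(x₀, x₁)}` is in Mantova–Masser's case (dim-π-S-1-free), its
unprojected exponential points are Zariski dense. [cite: MantovaMasser2023, §1 Further remarks,
p. 5 (the question, open in general)] (new) -/
theorem unprojectedDense_planeCurve_polyFibre_algebraic_of_mmCase (hFirr : Irreducible F)
    (halg : ∀ i j, IsAlgebraic ℚ ((F.coeff j).coeff i)) (R : MvPolynomial (Fin 2) ℂ)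
    (hmm : MMCaseDimPiOneFree {w : Fin 2 ⊕ Fin 2 → ℂ |
        (F.map (Polynomial.evalRingHom (w (Sum.inl 0)))).eval (w (Sum.inl 1)) = 0 ∧
        w (Sum.inr 0) = MvPolynomial.eval ![w (Sum.inl 0), w (Sum.inl 1)] R}) :
    UnprojectedDense {w : Fin 2 ⊕ Fin 2 → ℂ |
        (F.map (Polynomial.evalRingHom (w (Sum.inl 0)))).eval (w (Sum.inl 1)) = 0 ∧
        w (Sum.inr 0) = MvPolynomial.eval ![w (Sum.inl 0), w (Sum.inl 1)] R} := by
  classical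
  -- a torus point: `R ≠ 0` somewhere on the curve
  obtain ⟨w, hwW, hwT⟩ := hmm.2.1
  have hR : ∃ x y : ℂ, (F.map (Polynomial.evalRingHom x)).eval y = 0 ∧
      MvPolynomial.eval ![x, y] R ≠ 0 :=
    ⟨w (Sum.inl 0), w (Sum.inl 1), hwW.1, by rw [← hwW.2]; exact (mem_torusLocus_iff.1 hwT) 0⟩
  have hcl := zeroLocus_projAdd_planeCurve_polyFibre F hFirr R hR
  have hnotRat := hmm.2.2.2.2
  rw [hcl] at hnotRat
  by_cases hF1 : 1 ≤ F.natDegree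
  · by_cases hnl : F.natDegree = 1 → 1 ≤ F.leadingCoeff.natDegree ∨ 2 ≤ (F.coeff 0).natDegree
    · exact (unprojectedDensityQuestion_planeCurve_polyFibre_algebraic_of_notLine F hFirr hF1 hnl
        halg R hR).2
    · -- `F = c·x₁ + (αx₀ + β)`: the curve is the line `x₁ = a x₀ + b` (gen 18)
      push Not at hnl
      obtain ⟨h1, hlc, hb⟩ := hnl
      have hlc' : F.leadingCoeff = F.coeff 1 := by rw [Polynomial.leadingCoeff, h1]
      have hcdeg : (F.coeff 1).natDegree = 0 := by rw [← hlc']; omega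
      obtain ⟨c, hc⟩ : ∃ c : ℂ, F.coeff 1 = Polynomial.C c :=
        ⟨_, Polynomial.eq_C_of_natDegree_eq_zero hcdeg⟩
      have hc0 : c ≠ 0 := by
        rintro rfl
        rw [map_zero, ← hlc'] at hc
        exact (Polynomial.leadingCoeff_ne_zero.2 hFirr.ne_zero) hc
      have hℓ : F.coeff 0 = Polynomial.C ((F.coeff 0).coeff 1) * Polynomial.X +
          Polynomial.C ((F.coeff 0).coeff 0) :=
        Polynomial.eq_X_add_C_of_natDegree_le_one (by omega)
      set a : ℂ := -(F.coeff 0).coeff 1 / c with ha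
      set b : ℂ := -(F.coeff 0).coeff 0 / c with hb'
      refine unprojectedDense_of_mmCase_of_base_eq_line a b hmm ?_
      rw [hcl]
      ext x
      simp only [Set.mem_setOf_eq, eval_of_natDegree_eq_one F h1, hc, Polynomial.eval_C]
      rw [hℓ, Polynomial.eval_add, Polynomial.eval_mul, Polynomial.eval_C, Polynomial.eval_X,
        Polynomial.eval_C, ha, hb']
      constructor
      · intro h
        field_simp
        linear_combination h
      · intro h
        field_simp at h
        linear_combination h
  · -- `x₁`-degree `0`: the curve is a vertical line, of rational slope — excluded by the case
    exfalso
    apply hnotRat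
    have h0 : F.natDegree = 0 := by omega
    have hFC : F = Polynomial.C (F.coeff 0) := Polynomial.eq_C_of_natDegree_eq_zero h0
    have hfirr : Irreducible (F.coeff 0) := irreducible_of_irreducible_C (by rw [← hFC]; exact hFirr)
    have hf0 : F.coeff 0 ≠ 0 := hfirr.ne_zero
    obtain ⟨r, hr⟩ := Complex.exists_root
      (Polynomial.degree_pos_of_ne_zero_of_nonunit hf0 hfirr.not_isUnit)
    have hdeg1 : (F.coeff 0).degree = 1 := Polynomial.degree_eq_one_of_irreducible_of_root hfirr hr
    have hnat1 : (F.coeff 0).natDegree = 1 := Polynomial.natDegree_eq_of_degree_eq_some hdeg1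
    have hf : F.coeff 0 = Polynomial.C ((F.coeff 0).coeff 1) * Polynomial.X +
        Polynomial.C ((F.coeff 0).coeff 0) :=
      Polynomial.eq_X_add_C_of_natDegree_le_one (le_of_eq hnat1)
    have hf1 : (F.coeff 0).coeff 1 ≠ 0 := by
      have : (F.coeff 0).leadingCoeff ≠ 0 := Polynomial.leadingCoeff_ne_zero.2 hf0
      rwa [Polynomial.leadingCoeff, hnat1] at this
    have hev : ∀ x y : ℂ, (F.map (Polynomial.evalRingHom x)).eval y =
        (F.coeff 0).coeff 1 * x + (F.coeff 0).coeff 0 := by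
      intro x y
      rw [hFC, Polynomial.map_C, Polynomial.eval_C, Polynomial.coe_evalRingHom,
        Polynomial.coeff_C_zero]
      conv_lhs => rw [hf]
      simp
    refine ⟨![1, 0], by simp, -(F.coeff 0).coeff 0 / (F.coeff 0).coeff 1, ?_⟩
    ext x
    simp only [Set.mem_setOf_eq, hev, Matrix.cons_val_zero, Matrix.cons_val_one, Int.cast_one,
      Int.cast_zero, one_mul, zero_mul, add_zero]
    constructor
    · intro h
      field_simp
      linear_combination h
    · intro h
      field_simp at h
      linear_combination h

/-- **THE VERDICT, rational coefficients** (`F ∈ ℚ[x₀, x₁]` through a coefficient function).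
[cite: MantovaMasser2023, §1 Further remarks, p. 5 (the question, open in general)] (new) -/
theorem unprojectedDense_planeCurve_polyFibre_ratCoeff_of_mmCase (hFirr : Irreducible F)
    (c : ℕ → ℕ → ℚ) (hc : ∀ i j, (F.coeff j).coeff i = (c i j : ℂ)) (R : MvPolynomial (Fin 2) ℂ)
    (hmm : MMCaseDimPiOneFree {w : Fin 2 ⊕ Fin 2 → ℂ |
        (F.map (Polynomial.evalRingHom (w (Sum.inl 0)))).eval (w (Sum.inl 1)) = 0 ∧
        w (Sum.inr 0) = MvPolynomial.eval ![w (Sum.inl 0), w (Sum.inl 1)] R}) :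
    UnprojectedDense {w : Fin 2 ⊕ Fin 2 → ℂ |
        (F.map (Polynomial.evalRingHom (w (Sum.inl 0)))).eval (w (Sum.inl 1)) = 0 ∧
        w (Sum.inr 0) = MvPolynomial.eval ![w (Sum.inl 0), w (Sum.inl 1)] R} :=
  unprojectedDense_planeCurve_polyFibre_algebraic_of_mmCase F hFirr
    (fun i j => by rw [hc]; exact isAlgebraic_algebraMap (c i j)) R hmm

/-- The same in the shape of the question: over the class of polynomial-fibre surfaces
`{F = 0, y₀ = R}` with `F ∈ ℚ̄[x₀, x₁]` irreducible, "case ⟹ dense" holds without exception.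
[cite: MantovaMasser2023, §1 Further remarks, p. 5 (the question, open in general)] (new) -/
theorem unprojectedDensityQuestion_planeCurve_polyFibre_algebraic_all :
    ∀ F : ℂ[X][X], Irreducible F → (∀ i j, IsAlgebraic ℚ ((F.coeff j).coeff i)) →
      ∀ R : MvPolynomial (Fin 2) ℂ,
        MMCaseDimPiOneFree {w : Fin 2 ⊕ Fin 2 → ℂ |
            (F.map (Polynomial.evalRingHom (w (Sum.inl 0)))).eval (w (Sum.inl 1)) = 0 ∧
            w (Sum.inr 0) = MvPolynomial.eval ![w (Sum.inl 0), w (Sum.inl 1)] R} →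
          UnprojectedDense {w : Fin 2 ⊕ Fin 2 → ℂ |
            (F.map (Polynomial.evalRingHom (w (Sum.inl 0)))).eval (w (Sum.inl 1)) = 0 ∧
            w (Sum.inr 0) = MvPolynomial.eval ![w (Sum.inl 0), w (Sum.inl 1)] R} :=
  fun F hFirr halg R hmm => unprojectedDense_planeCurve_polyFibre_algebraic_of_mmCase F hFirr halg R hmm

/-- **Fibres in `y₁` over every plane curve over `ℚ̄`** (by the index swap `x₀ ↔ x₁`, `y₀ ↔ y₁` of
`Literature.…EACDensityTransport`).  `F` and its transpose `Fᵗ` (`Fᵗ(x, y) = F(y, x)`, supplied with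
the evaluation identity), `Fᵗ` irreducible of `x₁`-degree `≥ 2` (i.e. `deg_{x₀} F ≥ 2`) with algebraic
coefficients; `R` nonzero somewhere on the curve.  Then `{F = 0, y₁ = R(x₀, x₁)}` is in
Mantova–Masser's case AND dense. [cite: MantovaMasser2023, §1 Further remarks, p. 5 (the question,
open in general)] (new) -/
theorem unprojectedDensityQuestion_planeCurve_y1Fibre_algebraic (Ft : ℂ[X][X])
    (hFt : ∀ x y : ℂ, (Ft.map (Polynomial.evalRingHom x)).eval y =
      (F.map (Polynomial.evalRingHom y)).eval x)
    (hFtirr : Irreducible Ft) (hnt : 2 ≤ Ft.natDegree)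
    (halgt : ∀ i j, IsAlgebraic ℚ ((Ft.coeff j).coeff i)) (R : MvPolynomial (Fin 2) ℂ)
    (hR : ∃ x y : ℂ, (F.map (Polynomial.evalRingHom x)).eval y = 0 ∧ MvPolynomial.eval ![x, y] R ≠ 0) :
    MMCaseDimPiOneFree {w : Fin 2 ⊕ Fin 2 → ℂ |
        (F.map (Polynomial.evalRingHom (w (Sum.inl 0)))).eval (w (Sum.inl 1)) = 0 ∧
        w (Sum.inr 1) = MvPolynomial.eval ![w (Sum.inl 0), w (Sum.inl 1)] R} ∧
      UnprojectedDense {w : Fin 2 ⊕ Fin 2 → ℂ |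
        (F.map (Polynomial.evalRingHom (w (Sum.inl 0)))).eval (w (Sum.inl 1)) = 0 ∧
        w (Sum.inr 1) = MvPolynomial.eval ![w (Sum.inl 0), w (Sum.inl 1)] R} := by
  classical
  set R' : MvPolynomial (Fin 2) ℂ := MvPolynomial.rename (Equiv.swap (0 : Fin 2) 1) R with hR'
  have hR'ev : ∀ a b : ℂ, MvPolynomial.eval ![a, b] R' = MvPolynomial.eval ![b, a] R := by
    intro a b
    rw [hR', MvPolynomial.eval_rename]
    have e : ((![a, b] : Fin 2 → ℂ) ∘ ⇑(Equiv.swap (0 : Fin 2) 1)) = ![b, a] := by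
      funext i
      fin_cases i <;> rfl
    rw [e]
  have hR'' : ∃ x y : ℂ, (Ft.map (Polynomial.evalRingHom x)).eval y = 0 ∧
      MvPolynomial.eval ![x, y] R' ≠ 0 := by
    obtain ⟨x, y, hxy, hne⟩ := hR
    exact ⟨y, x, by rw [hFt]; exact hxy, by rw [hR'ev]; exact hne⟩
  have h := unprojectedDensityQuestion_planeCurve_polyFibre_algebraic Ft hFtirr hnt halgt R' hR''
  have hset : {w : Fin 2 ⊕ Fin 2 → ℂ |
      (F.map (Polynomial.evalRingHom (w (Sum.inl 0)))).eval (w (Sum.inl 1)) = 0 ∧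
      w (Sum.inr 1) = MvPolynomial.eval ![w (Sum.inl 0), w (Sum.inl 1)] R} =
      indexSwapped {w : Fin 2 ⊕ Fin 2 → ℂ |
        (Ft.map (Polynomial.evalRingHom (w (Sum.inl 0)))).eval (w (Sum.inl 1)) = 0 ∧
        w (Sum.inr 0) = MvPolynomial.eval ![w (Sum.inl 0), w (Sum.inl 1)] R'} := by
    ext z
    simp only [mem_indexSwapped_iff, Set.mem_setOf_eq, Function.comp_apply, idxSwap_inl_zero,
      idxSwap_inl_one, idxSwap_inr_zero, hFt, hR'ev]
  rw [hset]
  exact densityInstance_indexSwapped h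

/-- **Members of `EC(3,2)` (THEOREM F′ of gen 5).**  A threefold `W ⊆ ℂ³ × ℂ³` (irreducible closed,
meeting `G³`, of dimension `3`, torus part fibred in curves) whose projected surface is
`{F = 0, y₀ = R(x₀, x₁)}` for `F ∈ ℚ̄[x₀, x₁]` irreducible of `x₁`-degree `≥ 2` and `R` nonzero on the
curve, meets `Γ_exp` — unconditionally. [cite: MantovaMasser2023, §1 Further remarks, p. 5 (the
question, open in general)] (new) -/
theorem inter_expGraph_nonempty_of_fibred_over_algebraicCurve_polyFibre (hFirr : Irreducible F)
    (hn : 2 ≤ F.natDegree) (halg : ∀ i j, IsAlgebraic ℚ ((F.coeff j).coeff i))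
    (R : MvPolynomial (Fin 2) ℂ)
    (hR : ∃ x y : ℂ, (F.map (Polynomial.evalRingHom x)).eval y = 0 ∧ MvPolynomial.eval ![x, y] R ≠ 0)
    {W : Set (Fin (2 + 1) ⊕ Fin (2 + 1) → ℂ)}
    (hW : IsIrreducibleClosed ℂ W) (hne : (W ∩ torusLocus ℂ (2 + 1)).Nonempty)
    (hdim : zariskiDim ℂ W = (2 + 1 : ℕ))
    (hfib : zariskiDim ℂ (matrixAct (dropLastMat 2) '' (W ∩ torusLocus ℂ (2 + 1))) = (2 : ℕ))
    (hproj : MvPolynomial.zeroLocus ℂ (MvPolynomial.vanishingIdeal ℂ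
      ((fun (w : Fin (2 + 1) ⊕ Fin (2 + 1) → ℂ) (t : Fin 2 ⊕ Fin 2) =>
        w (Sum.map Fin.castSucc Fin.castSucc t)) '' (W ∩ torusLocus ℂ (2 + 1)))) =
      {w : Fin 2 ⊕ Fin 2 → ℂ |
        (F.map (Polynomial.evalRingHom (w (Sum.inl 0)))).eval (w (Sum.inl 1)) = 0 ∧
        w (Sum.inr 0) = MvPolynomial.eval ![w (Sum.inl 0), w (Sum.inl 1)] R}) :
    (W ∩ expGraph ℂ (2 + 1)).Nonempty := by
  refine inter_expGraph_nonempty_of_unprojectedDense_proj hW hne hdim hfib ?_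
  rw [hproj]
  exact (unprojectedDensityQuestion_planeCurve_polyFibre_algebraic F hFirr hn halg R hR).2


/-- **THE VERDICT for fibres in `y₁`.**  `Ft ∈ ℚ̄[x₀][x₁]` irreducible, the transpose of `F`
(`Ft(x, y) = F(y, x)`); `R ∈ ℂ[x₀, x₁]`: if `{F = 0, y₁ = R(x₀, x₁)}` is in Mantova–Masser's case then
its exponential points are Zariski dense (index swap). [cite: MantovaMasser2023, §1 Further
remarks, p. 5 (the question, open in general)] (new) -/
theorem unprojectedDense_planeCurve_y1Fibre_algebraic_of_mmCase (Ft : ℂ[X][X])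
    (hFt : ∀ x y : ℂ, (Ft.map (Polynomial.evalRingHom x)).eval y =
      (F.map (Polynomial.evalRingHom y)).eval x)
    (hFtirr : Irreducible Ft) (halgt : ∀ i j, IsAlgebraic ℚ ((Ft.coeff j).coeff i))
    (R : MvPolynomial (Fin 2) ℂ)
    (hmm : MMCaseDimPiOneFree {w : Fin 2 ⊕ Fin 2 → ℂ |
        (F.map (Polynomial.evalRingHom (w (Sum.inl 0)))).eval (w (Sum.inl 1)) = 0 ∧
        w (Sum.inr 1) = MvPolynomial.eval ![w (Sum.inl 0), w (Sum.inl 1)] R}) :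
    UnprojectedDense {w : Fin 2 ⊕ Fin 2 → ℂ |
        (F.map (Polynomial.evalRingHom (w (Sum.inl 0)))).eval (w (Sum.inl 1)) = 0 ∧
        w (Sum.inr 1) = MvPolynomial.eval ![w (Sum.inl 0), w (Sum.inl 1)] R} := by
  classical
  set R' : MvPolynomial (Fin 2) ℂ := MvPolynomial.rename (Equiv.swap (0 : Fin 2) 1) R with hR'
  have hR'ev : ∀ a b : ℂ, MvPolynomial.eval ![a, b] R' = MvPolynomial.eval ![b, a] R := by
    intro a b
    rw [hR', MvPolynomial.eval_rename]
    have e : ((![a, b] : Fin 2 → ℂ) ∘ ⇑(Equiv.swap (0 : Fin 2) 1)) = ![b, a] := by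
      funext i
      fin_cases i <;> rfl
    rw [e]
  have hset : {w : Fin 2 ⊕ Fin 2 → ℂ |
      (F.map (Polynomial.evalRingHom (w (Sum.inl 0)))).eval (w (Sum.inl 1)) = 0 ∧
      w (Sum.inr 1) = MvPolynomial.eval ![w (Sum.inl 0), w (Sum.inl 1)] R} =
      indexSwapped {w : Fin 2 ⊕ Fin 2 → ℂ |
        (Ft.map (Polynomial.evalRingHom (w (Sum.inl 0)))).eval (w (Sum.inl 1)) = 0 ∧
        w (Sum.inr 0) = MvPolynomial.eval ![w (Sum.inl 0), w (Sum.inl 1)] R'} := by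
    ext z
    simp only [mem_indexSwapped_iff, Set.mem_setOf_eq, Function.comp_apply, idxSwap_inl_zero,
      idxSwap_inl_one, idxSwap_inr_zero, hFt, hR'ev]
  rw [hset] at hmm ⊢
  have hmm' := mmCaseDimPiOneFree_indexSwapped hmm
  rw [indexSwapped_indexSwapped] at hmm'
  exact unprojectedDense_indexSwapped
    (unprojectedDense_planeCurve_polyFibre_algebraic_of_mmCase Ft hFtirr halgt R' hmm')

/-- **Members of `EC(3,2)`, verdict form.**  A threefold `W ⊆ ℂ³ × ℂ³` (irreducible closed, meeting
`G³`, of dimension `3`, torus part fibred in curves) whose projected surface is `{F = 0, y₀ = R}`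
with `F ∈ ℚ̄[x₀][x₁]` irreducible and that surface in Mantova–Masser's case meets `Γ_exp`.
[cite: MantovaMasser2023, §1 Further remarks, p. 5 (the question, open in general)] (new) -/
theorem inter_expGraph_nonempty_of_fibred_over_algebraicCurve_polyFibre_of_mmCase
    (hFirr : Irreducible F) (halg : ∀ i j, IsAlgebraic ℚ ((F.coeff j).coeff i))
    (R : MvPolynomial (Fin 2) ℂ)
    (hmm : MMCaseDimPiOneFree {w : Fin 2 ⊕ Fin 2 → ℂ |
        (F.map (Polynomial.evalRingHom (w (Sum.inl 0)))).eval (w (Sum.inl 1)) = 0 ∧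
        w (Sum.inr 0) = MvPolynomial.eval ![w (Sum.inl 0), w (Sum.inl 1)] R})
    {W : Set (Fin (2 + 1) ⊕ Fin (2 + 1) → ℂ)}
    (hW : IsIrreducibleClosed ℂ W) (hne : (W ∩ torusLocus ℂ (2 + 1)).Nonempty)
    (hdim : zariskiDim ℂ W = (2 + 1 : ℕ))
    (hfib : zariskiDim ℂ (matrixAct (dropLastMat 2) '' (W ∩ torusLocus ℂ (2 + 1))) = (2 : ℕ))
    (hproj : MvPolynomial.zeroLocus ℂ (MvPolynomial.vanishingIdeal ℂ
      ((fun (w : Fin (2 + 1) ⊕ Fin (2 + 1) → ℂ) (t : Fin 2 ⊕ Fin 2) =>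
        w (Sum.map Fin.castSucc Fin.castSucc t)) '' (W ∩ torusLocus ℂ (2 + 1)))) =
      {w : Fin 2 ⊕ Fin 2 → ℂ |
        (F.map (Polynomial.evalRingHom (w (Sum.inl 0)))).eval (w (Sum.inl 1)) = 0 ∧
        w (Sum.inr 0) = MvPolynomial.eval ![w (Sum.inl 0), w (Sum.inl 1)] R}) :
    (W ∩ expGraph ℂ (2 + 1)).Nonempty := by
  refine inter_expGraph_nonempty_of_unprojectedDense_proj hW hne hdim hfib ?_
  rw [hproj]
  exact unprojectedDense_planeCurve_polyFibre_algebraic_of_mmCase F hFirr halg R hmm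

end Verdict

end Summit.Schanuel.Schanuel.Theorems
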